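import Mathlib
import Summits.HodgeConjecture.FermatCycles.HodgeFermatDecodingA

/-!
# THEOREM F* at the prime levels by point evaluation — part 2: (U,U) and the dictionary at level `3p` (`HodgeFermat/Decoding.lean`)

Tree copy (part 2 of 3) of the module `HodgeFermat/Decoding.lean` of the sibling cell's standalone package
`run/shared/lean/pub/pub-hodgefermat/lean/HodgeFermat/` (688 lines, sha256 `9f6bff044f160188…`), source lines 256–444 (§6 (U,U): `stepUU`, `coreUU`; §7 the dictionary `muFun`/`nuFun` ↦ model functions on `ZMod p`, χ₃ bookkeeping, residues).
Filed by cell `pub-hfermat`, seat prover-1 gen-0, on the COORDINATOR KEEPER RULING of 2026-08-25 (gem sweep H1: take the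
off-gate kernel theorem `thmFstar` — `HodgeFermat/DecodingFinal.lean:29` — through the gate); this file is one link of the
minimal import closure of `thmFstar`.  The source module's declarations are VERBATIM those of the cell record
`check/DecodingFinal_standalone.lean` (27 bodies, 454 223 B, sha256 dca6f17de93119a6…, hub `lean check` rc 0, 130.1 s; pub-hodgefermat `CERT.md` l.978, GATE HF-G32).
Deviations from the source module, exhaustively: the `import` lines (tree modules `Summits.HodgeConjecture.FermatCycles.
HodgeFermat*` instead of `HodgeFermat.*`); this module docstring; the namespace/`open` preamble (source l.26–34) is repeated at the top because the module is split; `section Core` with its `variable` line (source l.73–75) is re-opened before source l.256 and the file ends with `end Level` + an `end` line; one-line docstrings added (gate lint) to `stepUU`, `coreUU`, `muEntry_unit`, `muEntry_three`, `nuEntry_unit`, `nuEntry_three`, `muFun_U`, `muFun_Z1`, `muFun_Z3`, `nuFun_U`, `nuFun_Z1`, `nuFun_Z3`, `chi3_congr`, `mod_eq_of_chi3_eq`, `chi3_neg`, `sum3_U`, `sum3_Z`, `three_dvd`, `p_dvd`, `ndvd_of_coprime`, `cast_ne_zero`, `third_ne_zero`, `num_ne_zero`, `numerals`, `zsum_U`,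 `zsum_Z1`, `zsum_Z3`. The module docstring is quoted in full in part 1.
Every other line — in particular every declaration's statement and proof — is byte-identical to the source.
HONEST FRAMING: explicit algebraic cycles for specific Hodge classes on Fermat/Delsarte varieties; residual open instances
listed; no claim on general Hodge.  (This file is arithmetic of CM types; it claims nothing about cycles.)
-/

set_option autoImplicit false

namespace HodgeFermat.KRFree.Decoding

open HodgeFermat.KRFree.LemmaN HodgeFermat.KRFree.LemmaEMu
open HodgeFermat.KRFree.MuEven (muEntry muFun mu_even)
open HodgeFermat.KRFree.NuOdd (nuEntry nuFun)
open HodgeFermat.KRFree.NuOddSharp (nu_odd' nu_sum_eq')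
open HodgeFermat.KRFree.ChiThree (chi3 chi3_ne_zero)

section Core

variable {F : Type*} [Field F] [DecidableEq F]

/-! ## 6. (U, U): per base point `3U ∈ T`, hence a ×3-cycle `U, 3U, 9U` and `13U = 0` -/

/-- (U, U), one step: the relations at the base point `U` force `3U ∈ T` (`V = 3U` or `W = 3U`) -/
lemma stepUU (h2 : (2 : F) ≠ 0) (h4 : (4 : F) ≠ 0) {U V W U' V' W' : F} (hs : U + V + W = 0)
    (hU : U ≠ 0) (hV : V ≠ 0) (hW : W ≠ 0) (hd1 : U' ≠ U) (hd2 : V' ≠ U) (hd3 : W' ≠ U)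
    (eU : mU U V W (-U) - mU U' V' W' (-U) = mU U V W U - mU U' V' W' U)
    (dU : nU U V W (-U) - nU U' V' W' (-U) = -(nU U V W U - nU U' V' W' U))
    (d3 : nU U V W (-(3 * U)) - nU U' V' W' (-(3 * U)) = -(nU U V W (3 * U) - nU U' V' W' (3 * U))) :
    V = 3 * U ∨ W = 3 * U := by
  have f1 : U ≠ -U := fun h => mul_ne h2 hU (by linear_combination h)
  have f2 : V ≠ -U := fun h => hW (by linear_combination hs - h)
  have f3 : W ≠ -U := fun h => hV (by linear_combination hs - h)
  have f4 : U ≠ 3 * U := fun h => mul_ne h2 hU (by linear_combination -h)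
  have f5 : U ≠ -(3 * U) := fun h => mul_ne h4 hU (by linear_combination h)
  simp only [mU, nU, mul_neg, ind_True, ind_neg f1, ind_neg f2, ind_neg f3, ind_neg f4, ind_neg f5,
    ind_neg hd1, ind_neg hd2, ind_neg hd3] at eU dU d3
  by_cases hV3 : V = 3 * U
  · exact Or.inl hV3
  by_cases hW3 : W = 3 * U
  · exact Or.inr hW3
  exfalso
  rw [ind_neg hV3, ind_neg hW3] at eU d3
  have := ind_bd (V = U); have := ind_bd (W = U)
  have := ind_bd (V = -(3 * U)); have := ind_bd (W = -(3 * U))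
  have := ind_bd (U' = 3 * U); have := ind_bd (V' = 3 * U); have := ind_bd (W' = 3 * U)
  have := ind_bd (U' = -(3 * U)); have := ind_bd (V' = -(3 * U)); have := ind_bd (W' = -(3 * U))
  have := ind_bd (U' = -U); have := ind_bd (V' = -U); have := ind_bd (W' = -U)
  omega

/-- (U, U): the ×3-cycle `U, 3U, 9U ∈ T` forces `13U = 0` — impossible when `13 ≠ 0` -/
theorem coreUU (h2 : (2 : F) ≠ 0) (h4 : (4 : F) ≠ 0) (h8 : (8 : F) ≠ 0) (h13 : (13 : F) ≠ 0)
    {U V W U' V' W' : F} (hs : U + V + W = 0)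
    (hU : U ≠ 0) (hV : V ≠ 0) (hW : W ≠ 0)
    (d11 : U' ≠ U) (d21 : V' ≠ U) (d31 : W' ≠ U) (d12 : U' ≠ V) (d22 : V' ≠ V) (d32 : W' ≠ V)
    (d13 : U' ≠ W) (d23 : V' ≠ W) (d33 : W' ≠ W)
    (hE : ∀ x, mU U V W (-x) - mU U' V' W' (-x) = mU U V W x - mU U' V' W' x)
    (hD : ∀ x, nU U V W (-x) - nU U' V' W' (-x) = -(nU U V W x - nU U' V' W' x)) : False := by
  have k1 := stepUU h2 h4 hs hU hV hW d11 d21 d31 (hE U) (hD U) (hD (3 * U))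
  have hs2 : V + U + W = 0 := by linear_combination hs
  have hs3 : W + U + V = 0 := by linear_combination hs
  have k2 := stepUU h2 h4 hs2 hV hU hW d12 d22 d32
    (by rw [mU_swap U V W (-V), mU_swap U V W V]; exact hE V)
    (by rw [nU_swap U V W (-V), nU_swap U V W V]; exact hD V)
    (by rw [nU_swap U V W (-(3 * V)), nU_swap U V W (3 * V)]; exact hD (3 * V))
  have k3 := stepUU h2 h4 hs3 hW hU hV d13 d23 d33
    (by rw [mU_rot U V W (-W), mU_rot U V W W]; exact hE W)
    (by rw [nU_rot U V W (-W), nU_rot U V W W]; exact hD W)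
    (by rw [nU_rot U V W (-(3 * W)), nU_rot U V W (3 * W)]; exact hD (3 * W))
  rcases k1 with hV3 | hW3
  · rcases k2 with h | h
    · exact mul_ne h8 hU (by linear_combination -1 * h - 3 * hV3)
    · exact mul_ne h13 hU (by linear_combination hs - 4 * hV3 - h)
  · rcases k3 with h | h
    · exact mul_ne h8 hU (by linear_combination -1 * h - 3 * hW3)
    · exact mul_ne h13 hU (by linear_combination hs - 4 * hW3 - h)

end Core


/-! ## 7. Dictionary: level `3p`, the functions `muFun` / `nuFun` of actual triples as model functions on `ZMod p` -/

section Level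

variable {p : ℕ}

/-- dictionary: `μ`-entry of an entry prime to `3` -/
lemma muEntry_unit {b : ℕ} (hb : ¬ 3 ∣ b) (x : ZMod p) :
    muEntry b x = ind ((b : ZMod p) = x) - ind ((b : ZMod p) = 3 * x) := by
  unfold muEntry ind; rw [if_neg hb]

/-- dictionary: `μ`-entry of an entry divisible by `3` -/
lemma muEntry_three {a : ℕ} (ha : 3 ∣ a) (x : ZMod p) :
    muEntry a x = 2 * ind (((a / 3 : ℕ) : ZMod p) = x) := by
  unfold muEntry ind; rw [if_pos ha]; split_ifs <;> norm_num

/-- dictionary: `ν`-entry of an entry prime to `3` -/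
lemma nuEntry_unit {b : ℕ} (hb : ¬ 3 ∣ b) (x : ZMod p) :
    nuEntry b x = chi3 b * ind ((b : ZMod p) = x) := by
  unfold nuEntry ind; rw [if_neg hb]; split_ifs <;> simp

/-- dictionary: `ν`-entry of an entry divisible by `3` is `0` -/
lemma nuEntry_three {a : ℕ} (ha : 3 ∣ a) (x : ZMod p) : nuEntry a x = 0 := by
  unfold nuEntry; rw [if_pos ha]

/-- `muFun` of a U triple is the model `mU` -/
lemma muFun_U {a b c : ℕ} (ha : ¬ 3 ∣ a) (hb : ¬ 3 ∣ b) (hc : ¬ 3 ∣ c) (x : ZMod p) :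
    muFun (a, b, c) x = mU (a : ZMod p) (b : ZMod p) (c : ZMod p) x := by
  simp only [muFun, mU, muEntry_unit ha, muEntry_unit hb, muEntry_unit hc]

/-- `muFun` of a Z1 triple `(3y, u, v)` is the model `mZ` -/
lemma muFun_Z1 {a b c : ℕ} (ha : 3 ∣ a) (hb : ¬ 3 ∣ b) (hc : ¬ 3 ∣ c) (x : ZMod p) :
    muFun (a, b, c) x = mZ ((a / 3 : ℕ) : ZMod p) (b : ZMod p) (c : ZMod p) x := by
  simp only [muFun, mZ, muEntry_three ha, muEntry_unit hb, muEntry_unit hc]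

/-- `muFun` of a Z3 triple is `2·nU` of the thirds -/
lemma muFun_Z3 {a b c : ℕ} (ha : 3 ∣ a) (hb : 3 ∣ b) (hc : 3 ∣ c) (x : ZMod p) :
    muFun (a, b, c) x = 2 * nU ((a / 3 : ℕ) : ZMod p) ((b / 3 : ℕ) : ZMod p) ((c / 3 : ℕ) : ZMod p) x := by
  simp only [muFun, nU, muEntry_three ha, muEntry_three hb, muEntry_three hc]; ring

/-- `nuFun` of a U triple in indicator form -/
lemma nuFun_U {a b c : ℕ} (ha : ¬ 3 ∣ a) (hb : ¬ 3 ∣ b) (hc : ¬ 3 ∣ c) (x : ZMod p) :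
    nuFun (a, b, c) x = chi3 a * ind ((a : ZMod p) = x) + chi3 b * ind ((b : ZMod p) = x)
      + chi3 c * ind ((c : ZMod p) = x) := by
  simp only [nuFun, nuEntry_unit ha, nuEntry_unit hb, nuEntry_unit hc]

/-- `nuFun` of a Z1 triple in indicator form -/
lemma nuFun_Z1 {a b c : ℕ} (ha : 3 ∣ a) (hb : ¬ 3 ∣ b) (hc : ¬ 3 ∣ c) (x : ZMod p) :
    nuFun (a, b, c) x = chi3 b * ind ((b : ZMod p) = x) + chi3 c * ind ((c : ZMod p) = x) := by
  simp only [nuFun, nuEntry_three ha, nuEntry_unit hb, nuEntry_unit hc, zero_add]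

/-- `nuFun` of a Z3 triple vanishes -/
lemma nuFun_Z3 {a b c : ℕ} (ha : 3 ∣ a) (hb : 3 ∣ b) (hc : 3 ∣ c) (x : ZMod p) : nuFun (a, b, c) x = 0 := by
  simp only [nuFun, nuEntry_three ha, nuEntry_three hb, nuEntry_three hc, add_zero]

/-! ### χ₃ bookkeeping (`chi3 x = 1, −1, 0` for `x ≡ 1, 2, 0 (mod 3)`) -/

/-- `χ₃` depends only on the residue mod `3` -/
lemma chi3_congr {u v : ℕ} (h : u % 3 = v % 3) : chi3 u = chi3 v := by
  unfold chi3; rw [h]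

/-- for `3 ∤ u`: `χ₃(u) = χ₃(v)` forces `u ≡ v (mod 3)` -/
lemma mod_eq_of_chi3_eq {u v : ℕ} (hu : ¬ 3 ∣ u) (h : chi3 u = chi3 v) : u % 3 = v % 3 := by
  unfold chi3 at h; split_ifs at h <;> omega

/-- `3 ∣ b + c`, `3 ∤ b`: `χ₃(c) = −χ₃(b)` -/
lemma chi3_neg {b c : ℕ} (hb : ¬ 3 ∣ b) (h : 3 ∣ b + c) : chi3 c = -chi3 b := by
  unfold chi3; split_ifs <;> omega

/-- a zero-sum triple prime to `3` has `Σχ₃ ≠ 0` -/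
lemma sum3_U {a b c : ℕ} (hs : 3 ∣ a + b + c) (ha : ¬ 3 ∣ a) (hb : ¬ 3 ∣ b) (hc : ¬ 3 ∣ c) :
    chi3 a + chi3 b + chi3 c ≠ 0 := by
  unfold chi3; split_ifs <;> omega

/-- a zero-sum triple with first entry divisible by `3` has `Σχ₃ = 0` -/
lemma sum3_Z {a b c : ℕ} (hs : 3 ∣ a + b + c) (ha : 3 ∣ a) : chi3 a + chi3 b + chi3 c = 0 := by
  unfold chi3; split_ifs <;> omega

/-! ### residues: the entries as elements of `ZMod p` -/

/-- `3p ∣ s ⟹ 3 ∣ s` -/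
lemma three_dvd {s : ℕ} (h : 3 * p ∣ s) : 3 ∣ s := dvd_trans (Dvd.intro p rfl) h

/-- `3p ∣ s ⟹ p ∣ s` -/
lemma p_dvd {s : ℕ} (h : 3 * p ∣ s) : p ∣ s := dvd_trans (Dvd.intro_left 3 rfl) h

/-- an entry prime to `p` is not divisible by `3p` -/
lemma ndvd_of_coprime (hp : p.Prime) {y : ℕ} (hy : Nat.Coprime y p) : ¬ 3 * p ∣ y :=
  fun h => hp.one_lt.ne' (Nat.Coprime.eq_one_of_dvd (Nat.coprime_comm.mp hy) (p_dvd h))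

/-- an entry prime to `p` is non-zero in `ZMod p` -/
lemma cast_ne_zero (hp : p.Prime) {y : ℕ} (hy : Nat.Coprime y p) : (y : ZMod p) ≠ 0 := by
  intro h
  rw [ZMod.natCast_eq_zero_iff] at h
  exact hp.one_lt.ne' (Nat.Coprime.eq_one_of_dvd (Nat.coprime_comm.mp hy) h)

/-- the third of an entry divisible by `3` and prime to `p` is non-zero in `ZMod p` -/
lemma third_ne_zero (hp : p.Prime) {y : ℕ} (hy : Nat.Coprime y p) (h3 : 3 ∣ y) : ((y / 3 : ℕ) : ZMod p) ≠ 0 :=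
  cast_ne_zero hp (Nat.Coprime.coprime_dvd_left (Nat.div_dvd_of_dvd h3) hy)

/-- the numerals `0 < n < 17`, `n ≠ 11` are non-zero in `ZMod p` for a prime `p ≥ 11`, `p ≠ 13` -/
lemma num_ne_zero (hp : p.Prime) (hp11 : 11 ≤ p) (hp13 : p ≠ 13) {n : ℕ} (h0 : 0 < n) (h17 : n < 17)
    (h11 : n ≠ 11) : (n : ZMod p) ≠ 0 := by
  intro h
  rw [ZMod.natCast_eq_zero_iff] at h
  have hle := Nat.le_of_dvd h0 h
  have hp16 : p ≤ 16 := by omega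
  interval_cases p <;> first | omega | exact absurd hp (by norm_num)

/-- `2, 3, 4, 5, 7, 8, 9, 13, 15 ≠ 0` in `ZMod p` for a prime `p ≥ 11`, `p ≠ 13` -/
lemma numerals (hp : p.Prime) (hp11 : 11 ≤ p) (hp13 : p ≠ 13) : (2 : ZMod p) ≠ 0 ∧ (3 : ZMod p) ≠ 0 ∧
    (4 : ZMod p) ≠ 0 ∧ (5 : ZMod p) ≠ 0 ∧ (7 : ZMod p) ≠ 0 ∧ (8 : ZMod p) ≠ 0 ∧ (9 : ZMod p) ≠ 0 ∧ (13 : ZMod p) ≠ 0 ∧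
    (15 : ZMod p) ≠ 0 := by
  refine ⟨?_, ?_, ?_, ?_, ?_, ?_, ?_, ?_, ?_⟩ <;>
    exact_mod_cast num_ne_zero hp hp11 hp13 (n := _) (by norm_num) (by norm_num) (by norm_num)

/-- disjointness mod `3p` of two entries in the same class mod 3 is disjointness mod `p` -/
lemma ne_of_nmod (hp : p.Prime) (hp3 : p ≠ 3) {u v : ℕ} (h3 : u % 3 = v % 3) (h : ¬ u ≡ v [MOD 3 * p]) :
    (v : ZMod p) ≠ (u : ZMod p) := by
  intro huv
  have h3p : Nat.Coprime 3 p := (Nat.coprime_primes Nat.prime_three hp).mpr (Ne.symm hp3)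
  exact h ((Nat.modEq_and_modEq_iff_modEq_mul h3p).mp ⟨h3, ((ZMod.natCast_eq_natCast_iff' v u p).mp huv).symm⟩)

/-- the same for two entries divisible by 3, in terms of their thirds -/
lemma third_ne_of_nmod {u v : ℕ} (h3u : 3 ∣ u) (h3v : 3 ∣ v) (h : ¬ u ≡ v [MOD 3 * p]) :
    ((v / 3 : ℕ) : ZMod p) ≠ ((u / 3 : ℕ) : ZMod p) := by
  intro huv
  have h1 : v / 3 ≡ u / 3 [MOD p] := (ZMod.natCast_eq_natCast_iff' _ _ p).mp huv
  have h2 := Nat.ModEq.mul_left' 3 h1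
  rw [Nat.mul_div_cancel' h3v, Nat.mul_div_cancel' h3u] at h2
  exact h h2.symm

/-- a zero-sum U triple sums to `0` in `ZMod p` -/
lemma zsum_U {a b c : ℕ} (hs : 3 * p ∣ a + b + c) :
    (a : ZMod p) + (b : ZMod p) + (c : ZMod p) = 0 := by
  have h := (ZMod.natCast_eq_zero_iff (a + b + c) p).mpr (p_dvd hs)
  push_cast at h
  exact h

/-- a zero-sum Z1 triple: `3·(a/3) + b + c = 0` in `ZMod p` -/
lemma zsum_Z1 {a b c : ℕ} (ha : 3 ∣ a) (hs : 3 * p ∣ a + b + c) :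
    3 * ((a / 3 : ℕ) : ZMod p) + (b : ZMod p) + (c : ZMod p) = 0 := by
  have e : 3 * (a / 3) + b + c = a + b + c := by omega
  have h := (ZMod.natCast_eq_zero_iff (3 * (a / 3) + b + c) p).mpr (e ▸ p_dvd hs)
  push_cast at h
  exact h

/-- a zero-sum Z3 triple: the thirds sum to `0` in `ZMod p` -/
lemma zsum_Z3 {a b c : ℕ} (ha : 3 ∣ a) (hb : 3 ∣ b) (hc : 3 ∣ c) (hs : 3 * p ∣ a + b + c) :
    ((a / 3 : ℕ) : ZMod p) + ((b / 3 : ℕ) : ZMod p) + ((c / 3 : ℕ) : ZMod p) = 0 := by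
  have h1 : p ∣ (a + b + c) / 3 := Nat.dvd_div_of_mul_dvd hs
  have e : (a + b + c) / 3 = a / 3 + b / 3 + c / 3 := by omega
  rw [e] at h1
  have h := (ZMod.natCast_eq_zero_iff (a / 3 + b / 3 + c / 3) p).mpr h1
  push_cast at h
  exact h


end Level

end HodgeFermat.KRFree.Decoding
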